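import Literature.AnabelianGeometry.EtaleTheta.Discharge.Sec4RootDivisors
import Literature.AlgebraicGeometry.Frobenioids.ModelFrobenioidPullbacks

/-!
# [EtTh] Prop 4.2 (iv) — the named fact `Prop42_iv` ("an isomorphism between the two given `N`-th
# roots of fraction-pairs") discharged for the model Frobenioid, modulo the [FrdI] inputs of the
# printed proof

Mochizuki, *The étale theta function …*, Publ. RIMS **45** (2009), §4, Prop. 4.2 (iv), PDF pp. 88–90
(printed 314–316) [cite: MochizukiEtTh2009, Prop 4.2(iv) p.89].  abc-iut cell, layer L2, node
`EtTh:Prop4.2(iv)` (seat abc-iut-w5-d063; statement typed by abc-iut-L2-t3 as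
`BiKummerSetting.Prop42_iv` in `BiKummerRoots.lean`; companion of abc-iut-L6-t12's
`Discharge/Sec4Prop42.lean` for (i)(ii)).

Printed proof (p.90 = PDF, printed p.316): "to verify the uniqueness up to isomorphism … let us first
observe that [δ = 1 WLOG]. Next, … it follows from the '`(N, H_⊙, f|_{A_N})`-saturated-ness' condition
… [cf. also Proposition 3.4, (ii)] that the pull-back `∈ O^×(A_N)` … of any element `∈ O^×(A_⊙)` [i.e.,
via the 'pull-back portion' of `α` — cf. Definition 4.1, (iv), (d)] admits an `N`-th root. Now … the
existence of a `ζ_A` as desired follows immediately from the uniqueness up to conjugation by a unit of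
base-Frobenius pairs of `A_N`, `A_N'` [cf. [FrdI], Proposition 5.6] …. The existence of a `ζ_B` as
desired follows from the equivalences of categories determined by pre-steps of [FrdI], Definition 1.3,
(iii), (d). The essential uniqueness … follows immediately from the various conditions imposed".

The statement is proved here over abc-iut-L2-t3's setting `S : BiKummerSetting X T D VD`, whose
Frobenioid `C = S.tf.category` IS the model Frobenioid of [FrdI] Thm. 5.2 (i) (objects `(A_D, a)`,
morphisms `(deg_Fr, Base, Div, u)`), for the typed rendering `Prop42_iv` (`δ = 1`, prescribed base
isomorphism `A' : A_N^bs ⥲ A_N'^bs` with `α^bs = α'^bs ∘ A'`).  The hypotheses are the inputs the printed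
proof cites, in the following form (nothing else is assumed):
* `hΦd`, `hBg` — `Φ` divisorial, `B` group-like ([FrdI] Thm. 5.2 (ii));
* `toB`, `hfrac` — the dictionary `O^×(A^birat) = B(A_D)^×` computing the fraction `s' · (s'')⁻¹`
  ([FrdI] Thm. 5.2 (ii)), exactly as in abc-iut-L6-t12's `prop42_i_of`; `hpull` — the same dictionary
  for the transport `((α')^birat)^*` (the parameter `pullFrac` of `Prop42_iv`): on `B(−)` it is
  `B(Base α')` ([FrdI] Prop. 1.11 (iv) / Thm. 5.2 (ii); for abc-iut-L2-t9's `pullFracModel` this is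
  `rfl`);
* `hnat` — [FrdI] Def. 2.7 (ii)/(iii): a base-Frobenius pair `(P, F)` has `F(n) ∈ End(P ↪ C)`, a
  NATURAL transformation whose components are base-identity endomorphisms of Frobenius degree `n`; so if
  `G, α', α''` arise from `(P, F)` (Def. 4.1 (iv)(e)), then `α'' ∘ ? = ? ∘ α''`: precisely
  `α' ∘ α''_A = φ_B ∘ α'` with `φ_B = F(n)_B` the `F`-distinguished endomorphism of the codomain;
* `hP56` — [FrdI] Prop. 5.6 (tree: `Frobenioids.PreFrobenioid.Prop56`, FACT-LIST F-0946) at the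
  Frobenius-trivial object `A_⊙` (for `C`, which is of model and unit-profinite type by [EtTh] Thm. 3.7
  (i)): the `F`-distinguished endomorphisms of `A_⊙` of a given Frobenius degree coming from two
  base-Frobenius pairs are conjugate by an element of `O^×(A_⊙)`;
* `hsat` — the displayed sentence of the printed proof (Def. 4.1 (iii) + [EtTh] Prop. 3.4 (ii)): for an
  `(N, H_⊙, g)`-saturated `A` and `α : A → A_⊙` of base-Frobenius type with `deg_Fr(α) = N`, the pull-back
  to `O^×(A)` along the pull-back portion `α'` of any element of `O^×(A_⊙)` is an `N`-th power in `O^×(A)`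
  (read in `B(A_D)` through the injection `O^×(A) ↪ B(A_D)`, `σ ↦ u_σ`, of [FrdI] Thm. 5.2 (ii)).
HONEST FRAMING: nothing here asserts that such data exist for an actual curve; typed ≠ proved for
Prop. 4.2 (iii); no side is taken on any disputed claim.
-/

noncomputable section

namespace Literature.AlgebraicGeometry.Frobenioids

namespace ModelFrobenioid

open CategoryTheory Opposite

universe w v u

variable {D : Type u} [Category.{v} D] {Φ B : Dᵒᵖ ⥤ CommMonCat.{w}} {DivB : B ⟶ monoidGp Φ}

/-- **Two pull-back morphisms into the same object over isomorphic bases are isomorphic over that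
base-isomorphism** (the universal property of pull-back morphisms, [FrdI] Def. 1.2 (ii), applied twice;
the step "`Ψ`, `α`, `α'` as pull-backs of `A_⊙`" behind the `ζ_A` of [EtTh] Prop. 4.2 (iv)): for
pull-back morphisms `φ : X → Y`, `φ' : X' → Y` and `e : X_D ⥲ X'_D` with `Base(φ) = Base(φ') ∘ e` there is
an isomorphism `ζ : X ⥲ X'` with `φ' ∘ ζ = φ` and `Base(ζ) = e`. [cite: MochizukiFrdI2008, Def. 1.2(ii)] -/
theorem exists_iso_of_isPullbackMorphism_of_baseMap_eq {X X' Y : ModelFrobenioid Φ B DivB}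
    {φ : X ⟶ Y} {φ' : X' ⟶ Y} (hφ : PreFrobenioid.IsPullbackMorphism (toElem Φ B DivB) φ)
    (hφ' : PreFrobenioid.IsPullbackMorphism (toElem Φ B DivB) φ') (e : X.base ≅ X'.base)
    (he : baseMap φ = e.hom ≫ baseMap φ') :
    ∃ ζ : X ≅ X', ζ.hom ≫ φ' = φ ∧ baseMap ζ.hom = e.hom := by
  obtain ⟨ζ, hζ⟩ := (hφ' X).2 ⟨(φ, e.hom), he⟩
  have hζ1 : ζ ≫ φ' = φ :=
    congrArg (fun p : PreFrobenioid.PullbackHomData (toElem Φ B DivB) φ' X => p.1.1) hζ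
  have hζ2 : baseMap ζ = e.hom :=
    congrArg (fun p : PreFrobenioid.PullbackHomData (toElem Φ B DivB) φ' X => p.1.2) hζ
  have he' : baseMap φ' = e.inv ≫ baseMap φ := by rw [he, e.inv_hom_id_assoc]
  obtain ⟨ζ', hζ'⟩ := (hφ X').2 ⟨(φ', e.inv), he'⟩
  have hζ'1 : ζ' ≫ φ = φ' :=
    congrArg (fun p : PreFrobenioid.PullbackHomData (toElem Φ B DivB) φ X' => p.1.1) hζ'
  have hζ'2 : baseMap ζ' = e.inv :=
    congrArg (fun p : PreFrobenioid.PullbackHomData (toElem Φ B DivB) φ X' => p.1.2) hζ'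
  have h1 : ζ ≫ ζ' = 𝟙 X := by
    apply (hφ X).1
    apply Subtype.ext
    apply Prod.ext
    · show (ζ ≫ ζ') ≫ φ = 𝟙 X ≫ φ
      rw [Category.assoc, hζ'1, hζ1, Category.id_comp]
    · show baseMap (ζ ≫ ζ') = baseMap (𝟙 X)
      rw [baseMap_comp, hζ2, hζ'2, e.hom_inv_id, baseMap_id]
  have h2 : ζ' ≫ ζ = 𝟙 X' := by
    apply (hφ' X').1
    apply Subtype.ext
    apply Prod.ext
    · show (ζ' ≫ ζ) ≫ φ' = 𝟙 X' ≫ φ'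
      rw [Category.assoc, hζ1, hζ'1, Category.id_comp]
    · show baseMap (ζ' ≫ ζ) = baseMap (𝟙 X')
      rw [baseMap_comp, hζ2, hζ'2, e.inv_hom_id, baseMap_id]
  exact ⟨⟨ζ, ζ', h1, h2⟩, hζ1, hζ2⟩

/-- **Units commute past a base-identity endomorphism up to the Frobenius degree**: for a
base-identity `ψ : X → X` of Frobenius degree `n` and `v, w ∈ O^×(X)` with `u_w = u_v ^ n`,
`ψ ∘ v = w ∘ ψ` (the computation behind "`α''` … of Frobenius type" absorbing `N`-th powers of units in
[EtTh] Prop. 4.2 (iv); `Φ` divisorial, so that `Div = 0` on `O^×`). [cite: MochizukiFrdI2008, Thm. 5.2(ii) p.101] -/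
theorem hom_comp_eq_comp_hom_of_unit_eq_pow (hΦd : Objectwise (fun M _ => IsDivisorial M) Φ)
    {X : ModelFrobenioid Φ B DivB} (ψ : X ⟶ X) (hψ : baseMap ψ = 𝟙 X.base) {v w : Aut X}
    (hv : v ∈ units X) (hw : w ∈ units X) (h : unit w.hom = unit v.hom ^ (degFr ψ : ℕ)) :
    v.hom ≫ ψ = ψ ≫ w.hom := by
  apply hom_ext
  · rw [degFr_comp, degFr_comp, hv.2, hw.2, one_mul, mul_one]
  · rw [baseMap_comp, baseMap_comp, hv.1, hw.1, hψ]
  · rw [div_comp_pull, div_comp_pull, div_eq_one_of_mem_units (hΦd X.base).isSharp hv,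
      div_eq_one_of_mem_units (hΦd X.base).isSharp hw, one_pow, mul_one, map_one, one_mul, hv.1,
      pull_id, hw.2, PNat.one_coe, pow_one]
  · rw [unit_comp_pull, unit_comp_pull, hv.1, hψ, pull_id, pull_id, hw.2, PNat.one_coe, pow_one, h,
      mul_comm]

end ModelFrobenioid

end Literature.AlgebraicGeometry.Frobenioids

namespace Literature.AnabelianGeometry.EtaleTheta

open CategoryTheory Opposite Literature.AlgebraicGeometry.Frobenioids
open Literature.AlgebraicGeometry.Frobenioids.PreFrobenioid (pull_injective)

universe u₀ v₀ u v w

variable {K : Type u₀} [Field K]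

namespace BiKummerSetting

variable {X : SemiGraphs.TemperedArithmeticGroup.{u₀} K} {D₀ : Type u₀} [Category.{v₀} D₀]
  {V : FrdIMonoidStub.{w}} {T : RealifiedDivisorMonoids (D₀ := D₀) V} {D : Type u} [Category.{v} D]
  {VD : FrdICatStub.{u, v, w} D} {S : BiKummerSetting X T D VD}

namespace NthRoot

variable {A Bo : S.C} {f : S.biratUnits A} {P : S.FractionPair f Bo} {N : ℕ+}
  {pullFrac : ∀ {A A' : S.C} (_ : A' ⟶ A), S.biratUnits A → S.biratUnits A'}
  (R : S.NthRoot f P N pullFrac)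

/-- The pull-back portion `α'` of `α` is linear with vanishing zero divisor (it is a pull-back morphism
of the model Frobenioid, Def. 4.1 (iv)(d); [FrdI] Def. 1.3 (iv)(b) for the model).
[cite: MochizukiEtTh2009, Prop 4.2(iii) p.88] -/
theorem degFr_α₁ (hΦd : Objectwise (fun M _ => IsDivisorial M) S.tf.divisorMonoid) :
    ModelFrobenioid.degFr R.αData.α₁ = 1 ∧ ModelFrobenioid.div R.αData.α₁ = 1 :=
  ModelFrobenioid.degFr_div_of_isPullbackMorphism hΦd R.αData.cond_d

/-- `Base(α') = Base(α)`: the factorization `α = α' ∘ α''` has `α''` a base-identity endomorphism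
(Def. 4.1 (iv)(c)). [cite: MochizukiEtTh2009, Prop 4.2(iii) p.88] -/
theorem baseMap_α₁ : ModelFrobenioid.baseMap R.αData.α₁ = ModelFrobenioid.baseMap R.α := by
  have hb : ModelFrobenioid.baseMap R.αData.α₂ = 𝟙 _ := R.αData.cond_c.1
  have h := congrArg ModelFrobenioid.baseMap R.αData.fac
  rw [ModelFrobenioid.baseMap_comp, hb, Category.id_comp] at h
  exact h

/-- `deg_Fr(α'') = N`: `deg_Fr(α) = N` (an `N`-th root), `α = α' ∘ α''`, `α'` linear.
[cite: MochizukiEtTh2009, Prop 4.2(iii) p.88] -/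
theorem degFr_α₂ (hΦd : Objectwise (fun M _ => IsDivisorial M) S.tf.divisorMonoid) :
    ModelFrobenioid.degFr R.αData.α₂ = N := by
  have h : ModelFrobenioid.degFr R.α = N := R.isIsometry.2.2.1
  rw [← R.αData.fac, ModelFrobenioid.degFr_comp, (R.degFr_α₁ hΦd).1, one_mul] at h
  exact h

/-- **`Div(s'_N) = (A')^* Div(s'_{N}')` for two `N`-th roots over a base-isomorphism `A'` with
`α^bs = α'^bs ∘ A'`**: both have `N`-th power `α^* Div(s')` and "`Φ(A_N)` is torsion-free" (`Φ`
divisorial). [cite: MochizukiEtTh2009, Prop 4.2(iv) p.90] -/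
theorem div_num_eq_pull_div_num (hΦd : Objectwise (fun M _ => IsDivisorial M) S.tf.divisorMonoid)
    (R' : S.NthRoot f P N pullFrac) (e : R.AN.base ≅ R'.AN.base)
    (he : ModelFrobenioid.baseMap R.α = e.hom ≫ ModelFrobenioid.baseMap R'.α) :
    ModelFrobenioid.div R.pair.num = pull S.tf.divisorMonoid e.hom (ModelFrobenioid.div R'.pair.num) := by
  apply pow_injective_of_isDivisorial (hΦd R.AN.base) N
  rw [R.div_num_pow, ← map_pow, R'.div_num_pow, ← pull_comp, ← he]

/-- The same for the divisors of poles: `Div(s''_N) = (A')^* Div(s''_{N}')`.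
[cite: MochizukiEtTh2009, Prop 4.2(iv) p.90] -/
theorem div_den_eq_pull_div_den (hΦd : Objectwise (fun M _ => IsDivisorial M) S.tf.divisorMonoid)
    (R' : S.NthRoot f P N pullFrac) (e : R.AN.base ≅ R'.AN.base)
    (he : ModelFrobenioid.baseMap R.α = e.hom ≫ ModelFrobenioid.baseMap R'.α) :
    ModelFrobenioid.div R.pair.den = pull S.tf.divisorMonoid e.hom (ModelFrobenioid.div R'.pair.den) := by
  apply pow_injective_of_isDivisorial (hΦd R.AN.base) N
  rw [R.div_den_pow, ← map_pow, R'.div_den_pow, ← pull_comp, ← he]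

end NthRoot

/-! ### Proposition 4.2 (iv) -/

/-- **[EtTh] Proposition 4.2 (iv) — the named fact `Prop42_iv` DISCHARGED modulo the [FrdI] inputs of
the printed proof** (p.89, proof p.90): given two `N`-th roots `R`, `R'` of a fraction-pair
`(s', s'') : A_⊙ → B` and a base-isomorphism `A' : A_N^bs ⥲ A_N'^bs` with `α^bs = α'^bs ∘ A'`, "after
possibly replacing `s''_N` by `u ∘ s''_N`, for some `u ∈ μ_N(B_N)`, there exist isomorphisms
`ζ_A : A_N ⥲ A_N'`, `ζ_B : B_N ⥲ B_N'` in `C` which fit into commutative diagrams [with `s'_N`, `s''_N`]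
and, moreover, satisfy `α = α' ∘ ζ_A`, `β = β' ∘ ζ_B`, `ζ_A^bs = A'`".  Proof as printed: `ζ_A` from
the pull-back portions `α'` (universal property of pull-back morphisms), the naturality of the
Frobenius section (`hnat`), [FrdI] Prop. 5.6 at `A_⊙` (`hP56`) and the `N`-th roots of pulled-back
units (`hsat`); `ζ_B` from [FrdI] Def. 1.3 (iii)(d) for the model (`exists_iso_comp_eq_of_div_eq`,
divisors compared through `N · Div(s'_N) = α^* Div(s')`); `u := ζ_B'' ∘ ζ_B⁻¹ ∈ O^×(B_N)` is killed by
`N` because both roots have `N`-th power `f|_{A_N}` (dictionary `toB`, `hfrac`, `hpull`).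
[cite: MochizukiEtTh2009, Prop 4.2(iv) p.89] -/
theorem prop42_iv_of
    (hΦd : Objectwise (fun M _ => IsDivisorial M) S.tf.divisorMonoid)
    (hBg : Objectwise (fun M _ => IsGroupLike M) S.tf.ratFnFunctor)
    (toB : ∀ A : S.C, S.biratUnits A →* (S.tf.ratFnFunctor.obj (op A.base))ˣ)
    (hfrac : ∀ {A B : S.C} (s' s'' : A ⟶ B) (h' : S.IsPreStep s') (h'' : S.IsPreStep s'')
      (hb : PreFrobenioid.BaseEquivalent S.F s' s''),
      (toB A (S.fracOf s' s'' h' h'' hb) : S.tf.ratFnFunctor.obj (op A.base)) *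
        ModelFrobenioid.unit s'' = ModelFrobenioid.unit s')
    {pullFrac : ∀ {A A' : S.C} (_ : A' ⟶ A), S.biratUnits A → S.biratUnits A'}
    (hpull : ∀ {A A' : S.C} (φ : A' ⟶ A) (x : S.biratUnits A),
      (toB A' (pullFrac φ x) : S.tf.ratFnFunctor.obj (op A'.base)) =
        pull S.tf.ratFnFunctor (ModelFrobenioid.baseMap φ) (toB A x : S.tf.ratFnFunctor.obj (op A.base)))
    (hnat : ∀ {A B : S.C} (G : Subgroup (Aut A)) (α₂ : A ⟶ A) (α₁ : A ⟶ B),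
      S.ArisesFromBaseFrobeniusPair G α₂ α₁ →
        ∃ φ : B ⟶ B, S.ArisesFromBaseFrobeniusPair ⊥ φ (𝟙 B) ∧ S.IsBaseIdentity φ ∧
          S.degFr φ = S.degFr α₂ ∧ α₂ ≫ α₁ = α₁ ≫ φ)
    (hP56 : ∀ {φ φ' : S.Aodot ⟶ S.Aodot}, S.ArisesFromBaseFrobeniusPair ⊥ φ (𝟙 S.Aodot) →
      S.ArisesFromBaseFrobeniusPair ⊥ φ' (𝟙 S.Aodot) → S.degFr φ = S.degFr φ' →
        ∃ ε : Aut S.Aodot, ε ∈ S.units S.Aodot ∧ φ' = ε.inv ≫ φ ≫ ε.hom)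
    (hsat : ∀ {A : S.C} {N : ℕ+} {g : S.biratUnits A}, S.IsSaturated A N g →
      ∀ {α : A ⟶ S.Aodot} (d : S.BaseFrobeniusTypeData α), S.degFr α = N →
        ∀ ε : Aut S.Aodot, ε ∈ S.units S.Aodot →
          ∃ r : Aut A, r ∈ S.units A ∧
            ModelFrobenioid.unit r.hom ^ (N : ℕ) =
              pull S.tf.ratFnFunctor (ModelFrobenioid.baseMap d.α₁) (ModelFrobenioid.unit ε.hom)) :
    S.Prop42_iv pullFrac := by
  intro Bo f P N R R' ebs hebs
  -- the base-isomorphism `A'`, retyped over `Base(A_N) = A_N.base`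
  obtain ⟨e, he⟩ : ∃ e : R.AN.base ≅ R'.AN.base, e.hom = ebs.hom :=
    ⟨⟨ebs.hom, ebs.inv, ebs.hom_inv_id, ebs.inv_hom_id⟩, rfl⟩
  have hebs' : ModelFrobenioid.baseMap R.α = e.hom ≫ ModelFrobenioid.baseMap R'.α := by
    rw [he]; exact hebs
  -- integrality / cancellation in `B(A_N)` and `Φ`
  haveI : IsCancelMul (S.tf.ratFnFunctor.obj (op R.AN.base)) :=
    isIntegral_iff_isCancelMul.mp (hBg R.AN.base).isPreDivisorial.isIntegral
  -- Step 0: the base-Frobenius-type data of `α`, `α'`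
  obtain ⟨hα₁lin, hα₁div⟩ := R.degFr_α₁ hΦd
  obtain ⟨hα₁lin', hα₁div'⟩ := R'.degFr_α₁ hΦd
  have hbα₁ := R.baseMap_α₁
  have hbα₁' := R'.baseMap_α₁
  have hα₂N := R.degFr_α₂ hΦd
  have hα₂N' := R'.degFr_α₂ hΦd
  -- Step 1: naturality of the Frobenius sections: `α = α' ∘ α'' = φ_B ∘ α'`
  obtain ⟨φB, hφB, hφBb, hφBdeg, hφBnat⟩ := hnat R.αData.G R.αData.α₂ R.αData.α₁ R.αData.cond_e
  obtain ⟨φB', hφB', hφBb', hφBdeg', hφBnat'⟩ := hnat R'.αData.G R'.αData.α₂ R'.αData.α₁ R'.αData.cond_e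
  have hα : R.α = R.αData.α₁ ≫ φB := R.αData.fac.symm.trans hφBnat
  have hα' : R'.α = R'.αData.α₁ ≫ φB' := R'.αData.fac.symm.trans hφBnat'
  -- Step 2: [FrdI] Prop. 5.6 at `A_⊙`: `φ_B' = ε⁻¹ φ_B ε` for some `ε ∈ O^×(A_⊙)`
  have hφBN : ModelFrobenioid.degFr φB = N :=
    (show ModelFrobenioid.degFr φB = ModelFrobenioid.degFr R.αData.α₂ from hφBdeg).trans hα₂N
  have hφBN' : ModelFrobenioid.degFr φB' = N :=
    (show ModelFrobenioid.degFr φB' = ModelFrobenioid.degFr R'.αData.α₂ from hφBdeg').trans hα₂N'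
  have hdegφ : S.degFr φB = S.degFr φB' := hφBN.trans hφBN'.symm
  obtain ⟨ε, hε, hφBε⟩ := hP56 hφB hφB' hdegφ
  have hεb : ModelFrobenioid.baseMap ε.hom = 𝟙 _ := hε.1
  -- Step 3: `ζ₁ : A_N ⥲ A_N'` over `A'` with `α'₁ ∘ ζ₁ = ε ∘ α₁` (pull-back morphisms)
  have hpb : PreFrobenioid.IsPullbackMorphism S.F (R.αData.α₁ ≫ ε.hom) := by
    apply ModelFrobenioid.isPullbackMorphism_of hΦd hBg
    · rw [ModelFrobenioid.degFr_comp, ModelFrobenioid.degFr_eq_one_of_isIso ε.hom, hα₁lin, mul_one]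
    · rw [ModelFrobenioid.div_comp_pull, ModelFrobenioid.div_eq_one_of_isIso hΦd ε.hom, map_one, one_mul,
        hα₁div, one_pow]
  have hbase : ModelFrobenioid.baseMap (R.αData.α₁ ≫ ε.hom) =
      e.hom ≫ ModelFrobenioid.baseMap R'.αData.α₁ := by
    rw [ModelFrobenioid.baseMap_comp, hεb, Category.comp_id, hbα₁, hbα₁']
    exact hebs'
  obtain ⟨ζ₁, hζ₁, hζ₁b⟩ :=
    ModelFrobenioid.exists_iso_of_isPullbackMorphism_of_baseMap_eq hpb R'.αData.cond_d e hbase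
  -- Step 4: `α' ∘ ζ₁ = ε ∘ α`
  have hζ₁α : ζ₁.hom ≫ R'.α = R.α ≫ ε.hom := by
    rw [hα', reassoc_of% hζ₁, hφBε, ε.hom_inv_id_assoc, ← Category.assoc, ← hα]
  -- Step 5: absorb `ε`: `ε ∘ α = α ∘ r` for a unit `r` of `A_N` with `r^N = (α')^* ε`
  obtain ⟨r, hr, hrN⟩ := hsat R.isSaturated R.αData R.isIsometry.2.2.1 ε hε
  have hρN : ModelFrobenioid.unitsPull R.αData.α₁ (⟨ε, hε⟩ : ModelFrobenioid.units S.Aodot) =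
      (⟨r, hr⟩ : ModelFrobenioid.units R.AN) ^ (N : ℕ) := by
    apply ModelFrobenioid.unitsToRatFn_injective (hΦd R.AN.base).isPreDivisorial.isIntegral
    apply Units.ext
    rw [map_pow, Units.val_pow_eq_pow_val, ModelFrobenioid.coe_unitsToRatFn_unitsPull,
      ModelFrobenioid.coe_unitsToRatFn, ModelFrobenioid.coe_unitsToRatFn]
    exact hrN.symm
  have hcomm₁ : ((⟨r, hr⟩ : ModelFrobenioid.units R.AN) ^ (N : ℕ)).1.hom ≫ R.αData.α₁ =
      R.αData.α₁ ≫ ε.hom := by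
    rw [← hρN]
    exact ModelFrobenioid.comp_eq_unitsPull_comp R.αData.α₁ hα₁lin _
  have hρNunit : ModelFrobenioid.unit ((⟨r, hr⟩ : ModelFrobenioid.units R.AN) ^ (N : ℕ)).1.hom =
      ModelFrobenioid.unit r.hom ^ (ModelFrobenioid.degFr R.αData.α₂ : ℕ) := by
    rw [hα₂N]
    have h := congrArg Units.val
      (map_pow (ModelFrobenioid.unitsToRatFn R.AN) (⟨r, hr⟩ : ModelFrobenioid.units R.AN) (N : ℕ))
    rw [Units.val_pow_eq_pow_val, ModelFrobenioid.coe_unitsToRatFn, ModelFrobenioid.coe_unitsToRatFn] at h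
    exact h
  have hcomm₂ : r.hom ≫ R.αData.α₂ =
      R.αData.α₂ ≫ ((⟨r, hr⟩ : ModelFrobenioid.units R.AN) ^ (N : ℕ)).1.hom :=
    ModelFrobenioid.hom_comp_eq_comp_hom_of_unit_eq_pow hΦd R.αData.α₂ R.αData.cond_c.1 hr
      ((⟨r, hr⟩ : ModelFrobenioid.units R.AN) ^ (N : ℕ)).2 hρNunit
  have hαε : R.α ≫ ε.hom = r.hom ≫ R.α := by
    rw [← R.αData.fac, Category.assoc, ← hcomm₁, reassoc_of% hcomm₂]
  -- Step 6: `ζ_A := ζ₁ ∘ r⁻¹`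
  let ζA : R.AN ≅ R'.AN := r.symm ≪≫ ζ₁
  have hζAα : ζA.hom ≫ R'.α = R.α := by
    change (r.inv ≫ ζ₁.hom) ≫ R'.α = R.α
    rw [Category.assoc, hζ₁α, hαε, r.inv_hom_id_assoc]
  have hζAb : ModelFrobenioid.baseMap ζA.hom = e.hom := by
    change ModelFrobenioid.baseMap (r.inv ≫ ζ₁.hom) = e.hom
    rw [ModelFrobenioid.baseMap_comp, (ModelFrobenioid.baseMap_inv_of_mem_units hr).1, Category.id_comp,
      hζ₁b]
  -- Step 7: `ζ_B`, `ζ_B''` along the pre-steps `s'_N`, `s''_N` ([FrdI] Def. 1.3 (iii)(d) for the model)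
  haveI : IsIso (ModelFrobenioid.baseMap R.pair.num) := R.pair.isPreStep_num.2
  haveI : IsIso (ModelFrobenioid.baseMap R.pair.den) := R.pair.isPreStep_den.2
  haveI : IsIso (ModelFrobenioid.baseMap (ζA.hom ≫ R'.pair.num)) :=
    (ModelFrobenioid.isPreStep_comp_of_isIso' ζA.hom R'.pair.isPreStep_num).2
  haveI : IsIso (ModelFrobenioid.baseMap (ζA.hom ≫ R'.pair.den)) :=
    (ModelFrobenioid.isPreStep_comp_of_isIso' ζA.hom R'.pair.isPreStep_den).2
  have hζAdeg : ModelFrobenioid.degFr ζA.hom = 1 := ModelFrobenioid.degFr_eq_one_of_isIso ζA.hom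
  have hn1 : ModelFrobenioid.degFr R.pair.num = 1 := R.pair.isPreStep_num.1
  have hd1 : ModelFrobenioid.degFr R.pair.den = 1 := R.pair.isPreStep_den.1
  have hn1' : ModelFrobenioid.degFr R'.pair.num = 1 := R'.pair.isPreStep_num.1
  have hd1' : ModelFrobenioid.degFr R'.pair.den = 1 := R'.pair.isPreStep_den.1
  obtain ⟨ζB, hζB⟩ := ModelFrobenioid.exists_iso_comp_eq_of_div_eq hBg R.pair.num (ζA.hom ≫ R'.pair.num)
    (by rw [ModelFrobenioid.degFr_comp, hζAdeg, mul_one, hn1, hn1'])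
    (by rw [ModelFrobenioid.div_comp_of_isIso' hΦd ζA.hom, hζAb]
        exact R.div_num_eq_pull_div_num hΦd R' e hebs')
  obtain ⟨ζB₃, hζB₃⟩ := ModelFrobenioid.exists_iso_comp_eq_of_div_eq hBg R.pair.den (ζA.hom ≫ R'.pair.den)
    (by rw [ModelFrobenioid.degFr_comp, hζAdeg, mul_one, hd1, hd1'])
    (by rw [ModelFrobenioid.div_comp_of_isIso' hΦd ζA.hom, hζAb]
        exact R.div_den_eq_pull_div_den hΦd R' e hebs')
  -- Step 8: `u := ζ_B'' ∘ ζ_B⁻¹ ∈ O^×(B_N)`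
  have hbP : ModelFrobenioid.baseMap R.pair.num = ModelFrobenioid.baseMap R.pair.den := R.pair.base_eq
  have hbP' : ModelFrobenioid.baseMap R'.pair.num = ModelFrobenioid.baseMap R'.pair.den := R'.pair.base_eq
  have hbζ : ModelFrobenioid.baseMap ζB₃.hom = ModelFrobenioid.baseMap ζB.hom := by
    have e1 : ModelFrobenioid.baseMap R.pair.num ≫ ModelFrobenioid.baseMap ζB.hom =
        ModelFrobenioid.baseMap ζA.hom ≫ ModelFrobenioid.baseMap R'.pair.num := by
      rw [← ModelFrobenioid.baseMap_comp, hζB, ModelFrobenioid.baseMap_comp]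
    have e2 : ModelFrobenioid.baseMap R.pair.den ≫ ModelFrobenioid.baseMap ζB₃.hom =
        ModelFrobenioid.baseMap ζA.hom ≫ ModelFrobenioid.baseMap R'.pair.den := by
      rw [← ModelFrobenioid.baseMap_comp, hζB₃, ModelFrobenioid.baseMap_comp]
    rw [← hbP, ← hbP', ← e1] at e2
    exact (cancel_epi _).mp e2
  let u : Aut R.BN := ζB₃ ≪≫ ζB.symm
  have hu : u ∈ S.units R.BN := ModelFrobenioid.trans_symm_mem_units ζB₃ ζB hbζ
  have huζ : u.hom ≫ ζB.hom = ζB₃.hom := by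
    change (ζB₃.hom ≫ ζB.inv) ≫ ζB.hom = ζB₃.hom
    rw [Category.assoc, ζB.inv_hom_id, Category.comp_id]
  -- Step 9: `u^N = 1`: the fraction computation
  have hζBdeg : ModelFrobenioid.degFr ζB.hom = 1 := ModelFrobenioid.degFr_eq_one_of_isIso ζB.hom
  have hub : ModelFrobenioid.baseMap u.hom = 𝟙 _ := hu.1
  have hxR := hfrac R.pair.num R.pair.den R.pair.isPreStep_num R.pair.isPreStep_den R.pair.base_eq
  have hxR' := hfrac R'.pair.num R'.pair.den R'.pair.isPreStep_num R'.pair.isPreStep_den R'.pair.base_eq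
  rw [R.pair.frac_eq] at hxR
  rw [R'.pair.frac_eq] at hxR'
  -- `E1`: units of `ζ_B ∘ s'_N = s'_{N}' ∘ ζ_A`; `E2`: units of `ζ_B'' ∘ s''_N = s''_{N}' ∘ ζ_A`
  have E1 := congrArg ModelFrobenioid.unit hζB
  rw [ModelFrobenioid.unit_comp_of_degFr_eq_one _ hζBdeg, ModelFrobenioid.unit_comp_of_degFr_eq_one _ hn1',
    hζAb, ← hxR, ← hxR', map_mul] at E1
  have E2 := congrArg ModelFrobenioid.unit hζB₃
  rw [← huζ, ← Category.assoc, ModelFrobenioid.unit_comp_of_degFr_eq_one _ hζBdeg,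
    ModelFrobenioid.baseMap_comp, hub, Category.comp_id, ModelFrobenioid.unit_comp_of_degFr_eq_one _ hu.2,
    ModelFrobenioid.unit_comp_of_degFr_eq_one _ hd1', hζAb, ← hbP] at E2
  -- E1 : c^*(u_ζB) * (x * u_den) = (e^* x' * e^* u_den') * u_ζA
  -- E2 : c^*(u_ζB) * (c^*(u_u) * u_den) = e^* u_den' * u_ζA
  have E3 : (toB R.AN R.root : S.tf.ratFnFunctor.obj (op R.AN.base)) =
      pull S.tf.ratFnFunctor e.hom (toB R'.AN R'.root : S.tf.ratFnFunctor.obj (op R'.AN.base)) *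
        pull S.tf.ratFnFunctor (ModelFrobenioid.baseMap R.pair.num) (ModelFrobenioid.unit u.hom) := by
    apply mul_left_cancel (a := pull S.tf.ratFnFunctor (ModelFrobenioid.baseMap R.pair.num)
      (ModelFrobenioid.unit ζB.hom))
    apply mul_right_cancel (b := ModelFrobenioid.unit R.pair.den)
    calc pull S.tf.ratFnFunctor (ModelFrobenioid.baseMap R.pair.num) (ModelFrobenioid.unit ζB.hom) *
          (toB R.AN R.root : S.tf.ratFnFunctor.obj (op R.AN.base)) * ModelFrobenioid.unit R.pair.den
        = pull S.tf.ratFnFunctor (ModelFrobenioid.baseMap R.pair.num) (ModelFrobenioid.unit ζB.hom) *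
          ((toB R.AN R.root : S.tf.ratFnFunctor.obj (op R.AN.base)) * ModelFrobenioid.unit R.pair.den) := by
            rw [mul_assoc]
      _ = pull S.tf.ratFnFunctor e.hom (toB R'.AN R'.root : S.tf.ratFnFunctor.obj (op R'.AN.base)) *
          (pull S.tf.ratFnFunctor e.hom (ModelFrobenioid.unit R'.pair.den) * ModelFrobenioid.unit ζA.hom) := by
            rw [E1, mul_assoc]
      _ = pull S.tf.ratFnFunctor e.hom (toB R'.AN R'.root : S.tf.ratFnFunctor.obj (op R'.AN.base)) *
          (pull S.tf.ratFnFunctor (ModelFrobenioid.baseMap R.pair.num) (ModelFrobenioid.unit ζB.hom) *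
            (pull S.tf.ratFnFunctor (ModelFrobenioid.baseMap R.pair.num) (ModelFrobenioid.unit u.hom) *
              ModelFrobenioid.unit R.pair.den)) := by rw [← E2]
      _ = pull S.tf.ratFnFunctor (ModelFrobenioid.baseMap R.pair.num) (ModelFrobenioid.unit ζB.hom) *
          (pull S.tf.ratFnFunctor e.hom (toB R'.AN R'.root : S.tf.ratFnFunctor.obj (op R'.AN.base)) *
            pull S.tf.ratFnFunctor (ModelFrobenioid.baseMap R.pair.num) (ModelFrobenioid.unit u.hom)) *
          ModelFrobenioid.unit R.pair.den := by
            simp only [mul_comm, mul_left_comm]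
  -- the `N`-th powers of both roots are `α^* f`
  have hxN : (toB R.AN R.root : S.tf.ratFnFunctor.obj (op R.AN.base)) ^ (N : ℕ) =
      pull S.tf.ratFnFunctor (ModelFrobenioid.baseMap R.α) (toB S.Aodot f : S.tf.ratFnFunctor.obj (op S.Aodot.base)) := by
    rw [← Units.val_pow_eq_pow_val, ← map_pow, R.pow_root, hpull, hbα₁]
  have hxN' : (pull S.tf.ratFnFunctor e.hom
      (toB R'.AN R'.root : S.tf.ratFnFunctor.obj (op R'.AN.base))) ^ (N : ℕ) =
      pull S.tf.ratFnFunctor (ModelFrobenioid.baseMap R.α) (toB S.Aodot f : S.tf.ratFnFunctor.obj (op S.Aodot.base)) := by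
    rw [← map_pow, ← Units.val_pow_eq_pow_val, ← map_pow, R'.pow_root, hpull, hbα₁', ← pull_comp, ← hebs']
  have huN' : pull S.tf.ratFnFunctor (ModelFrobenioid.baseMap R.pair.num) (ModelFrobenioid.unit u.hom) ^ (N : ℕ) = 1 := by
    have h := congrArg (fun y => y ^ (N : ℕ)) E3
    simp only [mul_pow] at h
    rw [hxN, hxN'] at h
    exact (mul_left_cancel ((mul_one _).trans h)).symm
  have huN : ModelFrobenioid.unit u.hom ^ (N : ℕ) = 1 := by
    apply pull_injective (ModelFrobenioid.baseMap R.pair.num)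
    rw [map_pow, huN', map_one]
  have huNAut : u ^ (N : ℕ) = 1 := by
    have h1 : (⟨u, hu⟩ : ModelFrobenioid.units R.BN) ^ (N : ℕ) = 1 := by
      apply ModelFrobenioid.unitsToRatFn_injective (hΦd R.BN.base).isPreDivisorial.isIntegral
      apply Units.ext
      rw [map_pow, map_one, Units.val_pow_eq_pow_val, ModelFrobenioid.coe_unitsToRatFn, Units.val_one]
      exact huN
    simpa only [SubmonoidClass.coe_pow, OneMemClass.coe_one] using congrArg Subtype.val h1
  have humu : u ∈ S.mu R.BN N := ⟨hu, huNAut⟩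
  -- Step 10: assemble
  refine ⟨⟨u, humu⟩, ζA, ζB, hζB.symm, ?_, hζAα, ?_, Iso.ext (hζAb.trans he)⟩
  · show ζA.hom ≫ R'.pair.den = (R.pair.den ≫ u.hom) ≫ ζB.hom
    rw [Category.assoc, huζ]
    exact hζB₃.symm
  · apply ModelFrobenioid.cancel_left_of_isIso_baseMap hΦd hBg R.pair.num
    rw [reassoc_of% hζB, R'.comm_num, reassoc_of% hζAα, R.comm_num]

end BiKummerSetting

end Literature.AnabelianGeometry.EtaleTheta

end
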